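import Summits.Ventures.YMGap.Thresholds.StarResolventDim
import Mathlib.Data.Fintype.Prod
import Mathlib.Algebra.BigOperators.Fin
import HarnessLib

/-!
# Venture YMGap — track (c) «DS» in GENERAL DIMENSION `d`: the Lemma-G super-solution and position
# count on the ABSTRACT star `Fin d × Bool` (direction, orientation) — pure combinatorics + arithmetic

HONEST FRAMING: venture file (cell `pub-ymgap`, seat ds-4, DIMENSION column of the `β₀(N, d)` table),
strong-coupling LATTICE bookkeeping; NO measure, NO torus, NO estimate of a kernel.  General-`d` form of
`StarColumn.lean` (`d = 4`, where the counting was done by `decide`); here the counting is done by hand,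
direction by direction (`Fin d × Bool ≃ Σ_μ {(μ, out), (μ, in)}`), so that `d` is a variable.

The vertex star of a site of `(ℤ/L)^d` has `2d` links, labelled abstractly by `(μ, o) : Fin d × Bool`;
two star links share a plaquette iff their directions differ.  For an ordered pair `(a, b)` of star links
with `a.1 ≠ b.1` (gauge fixed at `a`, partner `b`), Lemma G's super-solution assigns to a star link
`z ≠ a` the resolvent entry (`StarResolventDim`)

  `Dpos d c a b z = D_b` if `z = b`, `D_b̄` if `z` is opposite to `b`, `D_ā` if `z` is opposite to `a`,
  `D_g` otherwise.

Proved here, for every `d`: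
* `col_superSolution` — for `a.1 ≠ b.1`, `x ≠ a`, `0 ≤ c`, `Δ_d(c) > 0`:
  `[x = b] + c · Σ_{z ≠ a, z.1 ≠ x.1} Dpos d c a b z = Dpos d c a b x` (the three direction classes of
  `x` are the column equations `StarResolventDim.col_eq_b/bbar/abar/gen` after the direction-wise sums
  `sum_colSet_Dpos_of_fst_eq_partner/_frozen/_generic`);
* `sum_pairs_Dpos` — for every star link `x`:
  `Σ_{(a,b) : a.1 ≠ b.1, a ≠ x} Dpos d c a b x = (2d−2)(D_b + D_ā + D_b̄) + (2d−2)(2d−4) D_g`, hence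
  `received_sum_eq_gaugeR`: `c ·` that sum `= R_G^{(d)}(c)` (`StarResolventDim.gaugeR_eq_count`).

NOT here: the identification of the labels with torus links (`StarAdjacency.starLink`, any `d`, p3), the
kernels, the comparison theorem.  Nothing about the continuum or the mass gap.
-/

noncomputable section

open Finset

namespace Summit.Ventures.YMGap.StarColumnDim

open Summit.Ventures.YMGap.StarResolventDim

variable {d : ℕ}

/-- Abstract star-link labels in dimension `d`: (direction, orientation). -/
abbrev Dir (d : ℕ) := Fin d × Bool

/-! ### Opposite links and direction-wise sums -/

/-- The opposite star link (same direction, other orientation). [folklore] -/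
def opp (z : Dir d) : Dir d := (z.1, !z.2)

/-- The opposite link has the same direction. [folklore] -/
@[simp] theorem opp_fst (z : Dir d) : (opp z).1 = z.1 := rfl

/-- The opposite link is a different link. [folklore] -/
theorem opp_ne (z : Dir d) : opp z ≠ z := by
  rcases z with ⟨μ, o⟩; cases o <;> simp [opp]

/-- Two links of the same direction are equal or opposite. [folklore] -/
theorem eq_or_eq_opp {w z : Dir d} (h : w.1 = z.1) : w = z ∨ w = opp z := by
  rcases w with ⟨μ, o⟩; rcases z with ⟨ν, o'⟩
  simp only at h
  subst h
  cases o <;> cases o' <;> simp [opp]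

/-- A sum over the abstract star is a sum over directions of the two orientations. [folklore] -/
theorem sum_dir (F : Dir d → ℝ) : ∑ z, F z = ∑ μ : Fin d, ∑ o : Bool, F (μ, o) :=
  Fintype.sum_prod_type F

/-- The two links of the direction of `w` are `w` and `opp w`. [folklore] -/
theorem sum_bool_dir (F : Dir d → ℝ) (w : Dir d) : ∑ o : Bool, F (w.1, o) = F w + F (opp w) := by
  rcases w with ⟨μ, o⟩; cases o <;> simp [opp, add_comm]

/-- A sum over directions of a function constant (`= v`) off an exceptional set `T`:
`Σ_μ g μ = Σ_{μ ∈ T} g μ + (d − |T|)·v`. [folklore] -/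
theorem sum_fin_const_off (T : Finset (Fin d)) (g : Fin d → ℝ) (v : ℝ)
    (h : ∀ μ, μ ∉ T → g μ = v) : ∑ μ, g μ = ∑ μ ∈ T, g μ + ((d : ℝ) - T.card) * v := by
  rw [← Finset.sum_add_sum_compl T g]
  congr 1
  have hT : T.card ≤ d := (Finset.card_le_univ T).trans (Fintype.card_fin d).le
  rw [Finset.sum_congr rfl (fun μ hμ => h μ (Finset.mem_compl.1 hμ)), Finset.sum_const,
    Finset.card_compl, Fintype.card_fin, nsmul_eq_mul, Nat.cast_sub hT]

/-! ### The resolvent entry by position -/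

/-- **The super-solution entry** `D^{(a)}(z; b)` of Lemma G at the star link `z` (meaningful for
`z ≠ a`, `a.1 ≠ b.1`): `D_b` at the partner, `D_b̄` opposite to it, `D_ā` opposite to the frozen link,
`D_g` at the `2d − 4` generic links. [folklore] -/
def Dpos (d : ℕ) (c : ℝ) (a b z : Dir d) : ℝ :=
  if z = b then Db d c else if z.1 = b.1 then Dbbar d c else if z.1 = a.1 then Dabar d c else Dgen d c

/-- `Dpos` is nonnegative below the pole (`d ≥ 2`, `0 ≤ c`, `Δ_d(c) > 0`). [folklore] -/
theorem Dpos_nonneg (hd : 2 ≤ d) {c : ℝ} (h0 : 0 ≤ c) (hΔ : 0 < Delta d c) (a b z : Dir d) :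
    0 ≤ Dpos d c a b z := by
  obtain ⟨hb, hbb, hab, hg⟩ := col_nonneg hd h0 hΔ
  unfold Dpos
  split_ifs <;> assumption

/-- `Dpos` at the partner. [folklore] -/
theorem Dpos_partner (c : ℝ) (a b : Dir d) : Dpos d c a b b = Db d c := by simp [Dpos]

/-- `Dpos` opposite to the partner. [folklore] -/
theorem Dpos_opp_partner (c : ℝ) (a b : Dir d) : Dpos d c a b (opp b) = Dbbar d c := by
  simp [Dpos, opp_ne]

/-- `Dpos` at a link of the frozen direction (for `z ≠ a` this is `ā`). [folklore] -/
theorem Dpos_of_fst_eq_frozen (c : ℝ) {a b z : Dir d} (hab : a.1 ≠ b.1) (hz : z.1 = a.1) :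
    Dpos d c a b z = Dabar d c := by
  have hzb : z ≠ b := fun h => hab (hz ▸ (congrArg Prod.fst h))
  have hzb1 : z.1 ≠ b.1 := fun h => hab (hz ▸ h)
  rw [Dpos, if_neg hzb, if_neg hzb1, if_pos hz]

/-- `Dpos` at a generic link. [folklore] -/
theorem Dpos_of_generic (c : ℝ) {a b z : Dir d} (hza : z.1 ≠ a.1) (hzb : z.1 ≠ b.1) :
    Dpos d c a b z = Dgen d c := by
  have hzb' : z ≠ b := fun h => hzb (congrArg Prod.fst h)
  rw [Dpos, if_neg hzb', if_neg hzb, if_neg hza]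

/-! ### The super-solution sum over `colSet a x = {z ≠ a, z.1 ≠ x.1}` -/

/-- The set over which the super-solution inequality sums: star links `z ≠ a` not collinear with `x`
(`z.1 ≠ x.1`, i.e. sharing a plaquette with `x`). [folklore] -/
def colSet (a x : Dir d) : Finset (Dir d) :=
  univ.filter fun z => z ≠ a ∧ z.1 ≠ x.1

/-- The column sum in direction coordinates. [folklore] -/
theorem sum_colSet_eq_sum_dir (c : ℝ) (a b x : Dir d) :
    ∑ z ∈ colSet a x, Dpos d c a b z =
      ∑ μ : Fin d, ∑ o : Bool, if (μ, o) ≠ a ∧ μ ≠ x.1 then Dpos d c a b (μ, o) else 0 := by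
  rw [colSet, sum_filter, sum_dir]

/-- The direction-`μ` term of the column sum, generic direction: `2 D_g`. [folklore] -/
theorem colTerm_generic (c : ℝ) {a b x : Dir d} {μ : Fin d} (hμx : μ ≠ x.1) (hμa : μ ≠ a.1)
    (hμb : μ ≠ b.1) :
    (∑ o : Bool, if (μ, o) ≠ a ∧ μ ≠ x.1 then Dpos d c a b (μ, o) else 0) = 2 * Dgen d c := by
  have hne : ∀ o : Bool, ((μ, o) : Dir d) ≠ a := fun o h => hμa (congrArg Prod.fst h)
  have hval : ∀ o : Bool, Dpos d c a b (μ, o) = Dgen d c := fun o =>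
    Dpos_of_generic c (a := a) (b := b) (z := (μ, o)) hμa hμb
  rw [Fintype.sum_bool, if_pos ⟨hne true, hμx⟩, if_pos ⟨hne false, hμx⟩, hval, hval]
  ring

/-- The direction-`x.1` term of the column sum vanishes. [folklore] -/
theorem colTerm_self (c : ℝ) (a b x : Dir d) :
    (∑ o : Bool, if (x.1, o) ≠ a ∧ x.1 ≠ x.1 then Dpos d c a b (x.1, o) else 0) = 0 := by
  simp

/-- The direction-`a.1` term of the column sum (when `a.1 ≠ x.1`): only `ā` contributes, `D_ā`.
[folklore] -/
theorem colTerm_frozen (c : ℝ) {a b x : Dir d} (hab : a.1 ≠ b.1) (hax : a.1 ≠ x.1) :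
    (∑ o : Bool, if (a.1, o) ≠ a ∧ a.1 ≠ x.1 then Dpos d c a b (a.1, o) else 0) = Dabar d c := by
  rw [sum_bool_dir (fun z => if z ≠ a ∧ a.1 ≠ x.1 then Dpos d c a b z else 0) a]
  rw [if_neg (fun h => h.1 rfl), if_pos ⟨opp_ne a, hax⟩, zero_add]
  exact Dpos_of_fst_eq_frozen c hab (opp_fst a)

/-- The direction-`b.1` term of the column sum (when `b.1 ≠ x.1`, `a.1 ≠ b.1`): `b` and `b̄` contribute
`D_b + D_b̄`. [folklore] -/
theorem colTerm_partner (c : ℝ) {a b x : Dir d} (hab : a.1 ≠ b.1) (hbx : b.1 ≠ x.1) :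
    (∑ o : Bool, if (b.1, o) ≠ a ∧ b.1 ≠ x.1 then Dpos d c a b (b.1, o) else 0) =
      Db d c + Dbbar d c := by
  rw [sum_bool_dir (fun z => if z ≠ a ∧ b.1 ≠ x.1 then Dpos d c a b z else 0) b]
  have hba : b ≠ a := fun h => hab (by rw [h])
  have hba' : opp b ≠ a := fun h => hab (by rw [← h, opp_fst])
  rw [if_pos ⟨hba, hbx⟩, if_pos ⟨hba', hbx⟩, Dpos_partner, Dpos_opp_partner]

/-- **Column sum, `x` of the partner's direction** (`x = b` or `x = b̄`):
`Σ_{z ∈ colSet a x} Dpos = D_ā + (2d−4) D_g`. [folklore] -/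
theorem sum_colSet_Dpos_of_fst_eq_partner (c : ℝ) {a b x : Dir d} (hab : a.1 ≠ b.1)
    (hxb : x.1 = b.1) :
    ∑ z ∈ colSet a x, Dpos d c a b z = Dabar d c + (2 * (d : ℝ) - 4) * Dgen d c := by
  rw [sum_colSet_eq_sum_dir]
  have hax : a.1 ≠ x.1 := fun h => hab (h.trans hxb)
  rw [sum_fin_const_off ({a.1, b.1} : Finset (Fin d)) _ (2 * Dgen d c) (fun μ hμ => by
    simp only [mem_insert, mem_singleton, not_or] at hμ
    exact colTerm_generic c (fun h => hμ.2 (h.trans hxb)) hμ.1 hμ.2)]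
  rw [sum_pair hab, card_pair hab, colTerm_frozen c hab hax]
  have hb0 : (∑ o : Bool, if (b.1, o) ≠ a ∧ b.1 ≠ x.1 then Dpos d c a b (b.1, o) else 0) = 0 := by
    simp [hxb]
  rw [hb0]
  push_cast
  ring

/-- **Column sum, `x` opposite to the frozen link** (`x.1 = a.1`):
`Σ_{z ∈ colSet a x} Dpos = D_b + D_b̄ + (2d−4) D_g`. [folklore] -/
theorem sum_colSet_Dpos_of_fst_eq_frozen (c : ℝ) {a b x : Dir d} (hab : a.1 ≠ b.1)
    (hxa : x.1 = a.1) :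
    ∑ z ∈ colSet a x, Dpos d c a b z = Db d c + Dbbar d c + (2 * (d : ℝ) - 4) * Dgen d c := by
  rw [sum_colSet_eq_sum_dir]
  have hbx : b.1 ≠ x.1 := fun h => hab (h.trans hxa).symm
  rw [sum_fin_const_off ({a.1, b.1} : Finset (Fin d)) _ (2 * Dgen d c) (fun μ hμ => by
    simp only [mem_insert, mem_singleton, not_or] at hμ
    exact colTerm_generic c (fun h => hμ.1 (h.trans hxa)) hμ.1 hμ.2)]
  rw [sum_pair hab, card_pair hab, colTerm_partner c hab hbx]
  have ha0 : (∑ o : Bool, if (a.1, o) ≠ a ∧ a.1 ≠ x.1 then Dpos d c a b (a.1, o) else 0) = 0 := by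
    simp [hxa]
  rw [ha0]
  push_cast
  ring

/-- **Column sum, generic `x`** (`x.1 ∉ {a.1, b.1}`):
`Σ_{z ∈ colSet a x} Dpos = D_b + D_b̄ + D_ā + (2d−6) D_g`. [folklore] -/
theorem sum_colSet_Dpos_of_generic (c : ℝ) {a b x : Dir d} (hab : a.1 ≠ b.1)
    (hxa : x.1 ≠ a.1) (hxb : x.1 ≠ b.1) :
    ∑ z ∈ colSet a x, Dpos d c a b z =
      Db d c + Dbbar d c + Dabar d c + (2 * (d : ℝ) - 6) * Dgen d c := by
  rw [sum_colSet_eq_sum_dir]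
  rw [sum_fin_const_off ({x.1, a.1, b.1} : Finset (Fin d)) _ (2 * Dgen d c) (fun μ hμ => by
    simp only [mem_insert, mem_singleton, not_or] at hμ
    exact colTerm_generic c hμ.1 hμ.2.1 hμ.2.2)]
  have hx_not : x.1 ∉ ({a.1, b.1} : Finset (Fin d)) := by simp [hxa, hxb]
  rw [sum_insert hx_not, card_insert_of_notMem hx_not, sum_pair hab, card_pair hab, colTerm_self,
    colTerm_frozen c hab (Ne.symm hxa), colTerm_partner c hab (Ne.symm hxb)]
  push_cast
  ring

/-! ### The super-solution identity (hypothesis `hsol` of the window comparison) -/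

/-- **Column equation of Lemma G, abstract star, dimension `d`.**  For non-collinear `a, b`
(`a.1 ≠ b.1`), a star link `x ≠ a`, `0 ≤ c`, `Δ_d(c) > 0`:
`[x = b] + c · Σ_{z ≠ a, z.1 ≠ x.1} Dpos d c a b z = Dpos d c a b x` — the three direction classes of
`x` are exactly `col_eq_b`/`col_eq_bbar`, `col_eq_abar`, `col_eq_gen`. [folklore] -/
theorem col_superSolution {c : ℝ} (h0 : 0 ≤ c) (hΔ : 0 < Delta d c) {a b x : Dir d}
    (hab : a.1 ≠ b.1) (hxa : x ≠ a) :
    (if x = b then (1 : ℝ) else 0) + c * ∑ z ∈ colSet a x, Dpos d c a b z = Dpos d c a b x := by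
  by_cases hxb1 : x.1 = b.1
  · -- `x` is the partner `b` or its opposite
    rw [sum_colSet_Dpos_of_fst_eq_partner c hab hxb1]
    rcases eq_or_eq_opp hxb1 with hx | hx
    · subst hx
      rw [if_pos rfl, Dpos_partner]
      linear_combination (-1 : ℝ) * col_eq_b h0 hΔ
    · subst hx
      rw [if_neg (opp_ne b), Dpos_opp_partner]
      linear_combination (-1 : ℝ) * col_eq_bbar h0 hΔ
  · by_cases hxa1 : x.1 = a.1
    · -- `x` is opposite to the frozen link
      have hx : x ≠ b := fun h => hxb1 (by rw [h])
      rw [sum_colSet_Dpos_of_fst_eq_frozen c hab hxa1, if_neg hx, Dpos_of_fst_eq_frozen c hab hxa1]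
      linear_combination (-1 : ℝ) * col_eq_abar h0 hΔ
    · -- generic
      have hx : x ≠ b := fun h => hxb1 (by rw [h])
      rw [sum_colSet_Dpos_of_generic c hab hxa1 hxb1, if_neg hx, Dpos_of_generic c hxa1 hxb1]
      linear_combination (-1 : ℝ) * col_eq_gen h0 hΔ

/-! ### The count (hypothesis `hsum`: received sum `= R_G^{(d)}`) -/

/-- The ordered pairs `(a, b)` of non-collinear star links with `a ≠ x`. [folklore] -/
def pairSet (x : Dir d) : Finset (Dir d × Dir d) :=
  univ.filter fun p => p.1.1 ≠ p.2.1 ∧ p.1 ≠ x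

/-- Inner pair sum at a frozen link `a` of the direction of `x` (so `a = x̄`): every admissible partner
sees `x` opposite to the frozen link: `Σ_{b : b.1 ≠ a.1} Dpos a b x = (2d−2) D_ā`. [folklore] -/
theorem sum_partner_of_fst_eq (c : ℝ) {a x : Dir d} (hax : a.1 = x.1) :
    (∑ b : Dir d, if a.1 ≠ b.1 then Dpos d c a b x else 0) = (2 * (d : ℝ) - 2) * Dabar d c := by
  rw [sum_dir, sum_fin_const_off ({a.1} : Finset (Fin d)) _ (2 * Dabar d c) (fun ν hν => by
    simp only [mem_singleton] at hν
    have hν' : a.1 ≠ ν := Ne.symm hν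
    have hval : ∀ o : Bool, Dpos d c a (ν, o) x = Dabar d c := fun o =>
      Dpos_of_fst_eq_frozen c (a := a) (b := (ν, o)) (z := x) hν' hax.symm
    dsimp only
    rw [Fintype.sum_bool, if_pos hν', if_pos hν', hval, hval]
    ring)]
  rw [sum_singleton, card_singleton]
  have h0 : (∑ o : Bool, if a.1 ≠ ((a.1, o) : Dir d).1 then Dpos d c a (a.1, o) x else 0) = 0 := by
    simp
  rw [h0]
  push_cast
  ring

/-- Inner pair sum at a frozen link `a` of another direction:
`Σ_{b : b.1 ≠ a.1} Dpos a b x = D_b + D_b̄ + (2d−4) D_g`. [folklore] -/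
theorem sum_partner_of_fst_ne (c : ℝ) {a x : Dir d} (hax : a.1 ≠ x.1) :
    (∑ b : Dir d, if a.1 ≠ b.1 then Dpos d c a b x else 0) =
      Db d c + Dbbar d c + (2 * (d : ℝ) - 4) * Dgen d c := by
  rw [sum_dir, sum_fin_const_off ({x.1, a.1} : Finset (Fin d)) _ (2 * Dgen d c) (fun ν hν => by
    simp only [mem_insert, mem_singleton, not_or] at hν
    have hν' : a.1 ≠ ν := Ne.symm hν.2
    have hval : ∀ o : Bool, Dpos d c a (ν, o) x = Dgen d c := fun o =>
      Dpos_of_generic c (a := a) (b := (ν, o)) (z := x) (Ne.symm hax) (Ne.symm hν.1)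
    dsimp only
    rw [Fintype.sum_bool, if_pos hν', if_pos hν', hval, hval]
    ring)]
  have hxa : x.1 ∉ ({a.1} : Finset (Fin d)) := by simp [Ne.symm hax]
  rw [sum_insert hxa, sum_singleton, card_insert_of_notMem hxa, card_singleton]
  -- direction `x.1`: the partners `x` and `x̄`; direction `a.1`: excluded
  rw [sum_bool_dir (fun b => if a.1 ≠ b.1 then Dpos d c a b x else 0) x]
  have h1 : Dpos d c a x x = Db d c := Dpos_partner c a x
  have h2 : Dpos d c a (opp x) x = Dbbar d c := by
    have hx : x ≠ opp x := (opp_ne x).symm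
    rw [Dpos, if_neg hx, if_pos (opp_fst x).symm]
  have h0 : (∑ o : Bool, if a.1 ≠ ((a.1, o) : Dir d).1 then Dpos d c a (a.1, o) x else 0) = 0 := by
    simp
  dsimp only
  rw [if_pos hax, if_pos (show a.1 ≠ (opp x).1 from hax), h1, h2, h0]
  push_cast
  ring

/-- **The position count, abstract star, dimension `d`**: for every star link `x`,
`Σ_{(a,b) : a.1 ≠ b.1, a ≠ x} Dpos d c a b x = (2d−2)(D_b + D_ā + D_b̄) + (2d−2)(2d−4) D_g`. [folklore] -/
theorem sum_pairs_Dpos (c : ℝ) (x : Dir d) :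
    ∑ p ∈ pairSet x, Dpos d c p.1 p.2 x =
      (2 * (d : ℝ) - 2) * (Db d c + Dabar d c + Dbbar d c) +
        (2 * (d : ℝ) - 2) * (2 * (d : ℝ) - 4) * Dgen d c := by
  rw [pairSet, sum_filter, Fintype.sum_prod_type]
  -- inner sums
  have inner : ∀ a : Dir d, (∑ b : Dir d, if a.1 ≠ b.1 ∧ a ≠ x then Dpos d c a b x else 0) =
      if a ≠ x then (∑ b : Dir d, if a.1 ≠ b.1 then Dpos d c a b x else 0) else 0 := by
    intro a
    by_cases hax : a = x
    · rw [if_neg (not_not.2 hax)]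
      exact sum_eq_zero fun b _ => if_neg (fun h => h.2 hax)
    · rw [if_pos hax]
      exact sum_congr rfl fun b _ => by
        by_cases h1 : a.1 ≠ b.1
        · rw [if_pos ⟨h1, hax⟩, if_pos h1]
        · rw [if_neg (fun h => h1 h.1), if_neg h1]
  simp only [inner]
  rw [sum_dir, sum_fin_const_off ({x.1} : Finset (Fin d)) _
    (2 * (Db d c + Dbbar d c + (2 * (d : ℝ) - 4) * Dgen d c)) (fun μ hμ => by
      simp only [mem_singleton] at hμ
      have hne : ∀ o : Bool, ((μ, o) : Dir d) ≠ x := fun o h => hμ (congrArg Prod.fst h)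
      have hval : ∀ o : Bool, (∑ b : Dir d, if ((μ, o) : Dir d).1 ≠ b.1 then Dpos d c (μ, o) b x
          else 0) = Db d c + Dbbar d c + (2 * (d : ℝ) - 4) * Dgen d c := fun o =>
        sum_partner_of_fst_ne c (a := (μ, o)) hμ
      rw [Fintype.sum_bool, if_pos (hne true), if_pos (hne false), hval, hval]
      ring)]
  rw [sum_singleton, card_singleton,
    sum_bool_dir (fun a => if a ≠ x then (∑ b : Dir d, if a.1 ≠ b.1 then Dpos d c a b x else 0)
      else 0) x]
  rw [if_neg (fun h => h rfl), if_pos (opp_ne x), zero_add, sum_partner_of_fst_eq c (opp_fst x)]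
  push_cast
  ring

/-- **Received sum of the shared Lemma-G array equals `R_G^{(d)}(c)`**: for `0 ≤ c`, `Δ_d(c) > 0`,
`c · Σ_{(a,b) : a.1 ≠ b.1, a ≠ x} Dpos d c a b x = gaugeR d c` for every star link `x` (each unordered
pair carries two boundary links, each with weight `c/2` — so the per-link received sum is `c ·` the
ordered-pair sum). [folklore] -/
theorem received_sum_eq_gaugeR {c : ℝ} (h0 : 0 ≤ c) (hΔ : 0 < Delta d c) (x : Dir d) :
    c * ∑ p ∈ pairSet x, Dpos d c p.1 p.2 x = gaugeR d c := by
  rw [sum_pairs_Dpos, gaugeR_eq_count h0 hΔ]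

end Summit.Ventures.YMGap.StarColumnDim

end
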